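import Literature.NumberTheory.EllipticCurves.ManinSymbolsWeightKGamma1RankAllWeights
import Literature.NumberTheory.EllipticCurves.NewformsSpanGamma1Proofs
import Literature.NumberTheory.EllipticCurves.NewformGaloisRepIntegralityProofs
import HarnessLib

/-!
# Bounded denominators of rational cusp forms on `Γ₁(N)` (line `nsf`, crux `StarOptBNSF`, stmt-BirchSwinnertonDyer-27047)

**Stub S4 `stub_gamma1Bounded` of line `nsf` (v15), the print input «Shimura 1971, Thm. 3.52 / Deligne–Serre 1974
(2.7.2)» of the `E`-level route A″, CLOSED from the tree for every level `N ≥ 5` and weight `k ≥ 1`:**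
a cusp form `F ∈ S_k(Γ₁(N))` whose `q`-expansion at `∞` (Mathlib `qExpansion 1`, the tree's `cuspCoeff`) has RATIONAL
coefficients has bounded denominators — some `D ≠ 0` makes the `q`-expansion of `D·F` integral
(`exists_boundedDenominators_gamma1`).

The deep input is the tree's Deligne–Serre theorem `ManinK.span_integralLattice1_of_five_le` (`S_k(Γ₁(N))` is spanned
over `ℂ` by the lattice `integralLattice1` of forms all of whose diamond translates have integral coefficients; `N ≥ 5`,
`k ≥ 1`; from the Eichler–Shimura rank count and Shimura's Thm. 3.52 argument).  The descent from `ℂ` to `ℚ` is done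
WITHOUT Galois theory: pick a `ℂ`-basis `b` of `S_k(Γ₁(N))` inside the lattice and a `ℚ`-linear retraction
`π : ℂ → ℚ`; applying `π` to the rational identities `aₙ(F) = Σᵢ cᵢ aₙ(bᵢ)` (`aₙ(bᵢ) ∈ ℤ`) shows that the RATIONAL numbers
`π(cᵢ)` solve the same system, so `Σᵢ π(cᵢ) bᵢ` has the same `q`-expansion as `F`, hence equals `F`
(`eq_of_forall_cuspCoeff_eq_gamma1`); `D` is the product of the denominators of the `π(cᵢ)`.
BSD is not proved by this file; nothing here reads `r_an`.
-/

set_option linter.dupNamespace false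
set_option autoImplicit false

noncomputable section

open scoped MatrixGroups ModularForm
open CongruenceSubgroup UpperHalfPlane
open Literature.NumberTheory.EllipticCurves.ModularForms

namespace Summit.BirchSwinnertonDyer.BirchSwinnertonDyer.Theorems.DepletionAtTwo.Gamma1Bounded

/-- `aₙ(c • f) = c · aₙ(f)` on `Γ₁(N)`. [folklore] -/
theorem cuspCoeff_smul {N : ℕ} {k : ℤ} (c : ℂ) (f : CuspForm (Gamma1 N) k) (n : ℕ) :
    cuspCoeff (c • f) n = c * cuspCoeff f n := by
  show (cuspCoeffₗ (k := k) (HeckeTGamma1.one_mem_strictPeriods_Gamma1 N) n) (c • f) =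
    c * (cuspCoeffₗ (k := k) (HeckeTGamma1.one_mem_strictPeriods_Gamma1 N) n) f
  rw [map_smul, smul_eq_mul]

/-- `aₙ(Σᵢ fᵢ) = Σᵢ aₙ(fᵢ)` on `Γ₁(N)`. [folklore] -/
theorem cuspCoeff_sum {N : ℕ} {k : ℤ} {ι : Type*} (s : Finset ι) (f : ι → CuspForm (Gamma1 N) k) (n : ℕ) :
    cuspCoeff (∑ i ∈ s, f i) n = ∑ i ∈ s, cuspCoeff (f i) n := by
  show (cuspCoeffₗ (k := k) (HeckeTGamma1.one_mem_strictPeriods_Gamma1 N) n) (∑ i ∈ s, f i) =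
    ∑ i ∈ s, (cuspCoeffₗ (k := k) (HeckeTGamma1.one_mem_strictPeriods_Gamma1 N) n) (f i)
  exact map_sum _ f s

/-- **Bounded denominators on `Γ₁(N)`** (`N ≥ 5`, `k ≥ 1`): a cusp form with rational Fourier coefficients at `∞`
has an integral multiple.  [cite: ShimuraIATAF1971, Thm. 3.52] [cite: DeligneSerreASENS1974, Prop. 2.7 (2.7.2)] -/
theorem exists_boundedDenominators_gamma1 {N : ℕ} [NeZero N] (hN : 5 ≤ N) {k : ℤ} (hk : 1 ≤ k)
    (F : CuspForm (Gamma1 N) k) (hrat : ∀ n : ℕ, ∃ r : ℚ, cuspCoeff F n = (r : ℂ)) :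
    ∃ D : ℕ, D ≠ 0 ∧ ∀ n : ℕ, ∃ z : ℤ, cuspCoeff ((D : ℂ) • F) n = (z : ℂ) := by
  classical
  set L := integralLattice1 N k with hL
  have hspan : Submodule.span ℂ (L : Set (CuspForm (Gamma1 N) k)) = ⊤ :=
    ManinK.span_integralLattice1_of_five_le N hN k hk
  -- a `ℂ`-basis inside the lattice
  obtain ⟨B, hBL, hBspan, hBli⟩ := exists_linearIndependent ℂ (L : Set (CuspForm (Gamma1 N) k))
  have htop : ⊤ ≤ Submodule.span ℂ (Set.range ((↑) : B → CuspForm (Gamma1 N) k)) := by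
    rw [Subtype.range_coe, hBspan, hspan]
  let b : Module.Basis B ℂ (CuspForm (Gamma1 N) k) := Module.Basis.mk hBli htop
  have hb : ∀ i, b i = (i : CuspForm (Gamma1 N) k) := fun i ↦ Module.Basis.mk_apply hBli htop i
  have hbint : ∀ (i : B) (n : ℕ), ∃ z : ℤ, (z : ℂ) = cuspCoeff (b i) n := fun i n ↦ by
    rw [hb]; exact exists_int_eq_cuspCoeff_of_mem_integralLattice1 (hBL i.2) n
  choose z hz using hbint
  choose r hr using hrat
  -- the `ℚ`-linear retraction and the rational recombination
  obtain ⟨π, hπ⟩ : ∃ π : ℂ →ₗ[ℚ] ℚ, ∀ q : ℚ, π (q : ℂ) = q := by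
    -- (the tree's `Literature.Geometry.Kaehler.ComplexTorus.exists_ratLinear_retraction`, inlined to keep imports light)
    obtain ⟨g, hg⟩ := LinearMap.exists_leftInverse_of_injective (Algebra.linearMap ℚ ℂ)
      (LinearMap.ker_eq_bot.mpr (algebraMap ℚ ℂ).injective)
    exact ⟨g, fun q ↦ by simpa using LinearMap.congr_fun hg q⟩
  set c := b.repr F with hc
  set s := c.support with hs
  have hF : F = ∑ i ∈ s, c i • b i := by
    conv_lhs => rw [← b.linearCombination_repr F]
    rfl
  have hFn : ∀ n, cuspCoeff F n = ∑ i ∈ s, c i * cuspCoeff (b i) n := fun n ↦ by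
    conv_lhs => rw [hF]
    rw [cuspCoeff_sum]
    exact Finset.sum_congr rfl fun i _ ↦ cuspCoeff_smul _ _ _
  set G : CuspForm (Gamma1 N) k := ∑ i ∈ s, ((π (c i) : ℚ) : ℂ) • b i with hG
  have hGn : ∀ n, cuspCoeff G n = ∑ i ∈ s, ((π (c i) : ℚ) : ℂ) * cuspCoeff (b i) n := fun n ↦ by
    rw [hG, cuspCoeff_sum]
    exact Finset.sum_congr rfl fun i _ ↦ cuspCoeff_smul _ _ _
  -- applying `π` to the rational identity `aₙ(F) = Σ cᵢ aₙ(bᵢ)`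
  have hπr : ∀ n, r n = ∑ i ∈ s, π (c i) * (z i n : ℚ) := by
    intro n
    have h1 : (r n : ℂ) = ∑ i ∈ s, c i * (z i n : ℂ) := by
      rw [← hr n, hFn n]
      exact Finset.sum_congr rfl fun i _ ↦ by rw [hz]
    have h2 : π (r n : ℂ) = π (∑ i ∈ s, c i * (z i n : ℂ)) := by rw [h1]
    rw [hπ, map_sum] at h2
    rw [h2]
    refine Finset.sum_congr rfl fun i _ ↦ ?_
    have : c i * (z i n : ℂ) = ((z i n : ℚ)) • c i := by
      rw [Rat.smul_def]; push_cast; ring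
    rw [this, map_smul, smul_eq_mul, mul_comm]
  have hGF : G = F := by
    refine eq_of_forall_cuspCoeff_eq_gamma1 fun n ↦ ?_
    rw [hGn, hr n, hπr n]
    push_cast
    exact Finset.sum_congr rfl fun i _ ↦ by rw [hz]
  -- the common denominator
  set D : ℕ := ∏ i ∈ s, (π (c i)).den with hD
  have hD0 : D ≠ 0 := Finset.prod_ne_zero_iff.mpr fun i _ ↦ (π (c i)).den_nz
  have hDint : ∀ i ∈ s, ∃ w : ℤ, (w : ℚ) = (D : ℚ) * π (c i) := by
    intro i hi
    obtain ⟨e, he⟩ : (π (c i)).den ∣ D := Finset.dvd_prod_of_mem _ hi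
    refine ⟨(e : ℤ) * (π (c i)).num, ?_⟩
    rw [he]
    push_cast
    have := Rat.mul_den_eq_num (π (c i))
    linear_combination -(e : ℚ) * this
  choose! w hw using hDint
  refine ⟨D, hD0, fun n ↦ ⟨∑ i ∈ s, w i * z i n, ?_⟩⟩
  rw [cuspCoeff_smul, ← hGF, hGn]
  push_cast
  rw [Finset.mul_sum]
  refine Finset.sum_congr rfl fun i hi ↦ ?_
  rw [← hz, ← mul_assoc]
  congr 1
  have := hw i hi
  exact_mod_cast this.symm

/-- **Stub S4 of line `nsf` (v15), registered signature**: for `N ≥ 5`, every weight `k ≥ 1` and every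
`F ∈ S_k(Γ₁(N))` with rational `q`-expansion coefficients at `∞` (`qExpansion 1`), some `D ≠ 0` makes the
`q`-expansion of `τ ↦ D·F(τ)` integral. [cite: ShimuraIATAF1971, Thm. 3.52] [cite: DeligneSerreASENS1974, Prop. 2.7] -/
theorem stub_gamma1Bounded :
    ∀ (N : ℕ) [NeZero N], 5 ≤ N → ∀ (k : ℤ), 1 ≤ k → ∀ (F : CuspForm (CongruenceSubgroup.Gamma1 N) k),
      (∀ n : ℕ, ∃ r : ℚ, PowerSeries.coeff n (UpperHalfPlane.qExpansion (1 : ℝ) F) = (r : ℂ)) →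
      ∃ D : ℕ, D ≠ 0 ∧ ∀ n : ℕ, ∃ z : ℤ,
        PowerSeries.coeff n
          (UpperHalfPlane.qExpansion (1 : ℝ) (fun τ : UpperHalfPlane ↦ (D : ℂ) * F τ)) = (z : ℂ) := by
  intro N _ hN k hk F hrat
  obtain ⟨D, hD0, hint⟩ := exists_boundedDenominators_gamma1 hN hk F hrat
  refine ⟨D, hD0, fun n ↦ ?_⟩
  obtain ⟨z, hz⟩ := hint n
  refine ⟨z, ?_⟩
  have hfun : (fun τ : UpperHalfPlane ↦ (D : ℂ) * F τ) = ⇑((D : ℂ) • F) := by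
    funext τ; simp [smul_eq_mul]
  rw [hfun]
  exact hz

end Summit.BirchSwinnertonDyer.BirchSwinnertonDyer.Theorems.DepletionAtTwo.Gamma1Bounded

end
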